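import Literature.MathematicalPhysics.QuantumFieldTheory.Balaban1983to89.Beta.ResolventReflection
import Summits.QuantumFields.BalabanUV.Beta.StepLambdaReflection
import Summits.QuantumFields.BalabanUV.Beta.S0NAtReflection

/-!
# Beta / VertexReflectionContact — the chain-rule vertex, the resolvent sandwich and the `mm`-read of a stencil family
# whose axis-reflection law carries a CONTACT term (β sub-cell, row D1, hR leaf (L3) pre-leaf algebra; unit
# `b2b-balaban-beta-an3` gen 29, node «E3-LAW AT LEVEL 1»)

HONEST FRAMING.  Discharging `BetaPertH` makes Balaban's ultraviolet stability UNCONDITIONAL — a real constructive-QFT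
result; it is NOT the continuum limit and NOT the Clay problem.  HONEST DEPENDENCY: continuum YM on `T⁴` ⇐ `BetaPertH` ∧ nine
spine estimates (0/9 proved); `BetaPertH` ⇐ (D1) ∧ (D4) ∧ CAP+tail.  ABSOLUTE RULE: nothing in this module is a cited fact —
every statement is kernel-checked neutral algebra over the tree's own definitions ([folklore]).

WHAT THIS MODULE IS FOR.  `ResolventReflection.vertexOfK_reflect` transports a PURE-SIGN reflection law of a stencil family
`S κ′ (bref α κ′ u) = ε_{κ′} • refK Φ (S κ′ u)` to the chain-rule vertex `vertexOfK K N S`.  The step-0 rooted stencil of the spine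
does NOT obey a pure-sign law: `S0NAtReflection.S0NAt_bref` (p207579) has a CONTACT term,
`S0NAt … κ′ (bref α κ′ u) = ε • refK (Φ Lc α) (S0NAt … κ′ u + conjV (bhKAt …) (γ • diagK (ctGen d α Lc κ′ u)))`.
The third jet `SpineRooted.e3NAtOf … 1 κ′ u′ = −mmRead Lc (KInv ∘ vertexOf (S0NAt …) κ′ u′ ∘ KInv)` therefore inherits a contact,
and the hR leaf (L3) (`hE3ff` of `SpineRooted.SstepNAt_bref_of_e3Law`, p206556) is a statement about ITS SHAPE.  This module proves the
three pieces of neutral algebra that carry ANY contact family `C` through the three operations — vertex (§1), resolvent sandwich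
(§2) and `mm`-read (§3) — with every summability binder explicit, plus (§4) the contraction of a family of DIAGONAL contacts
through the vertex weights (`vertexOfK K N (κ u ↦ conjV 𝕄 (diagK (g κ u))) = conjV 𝕄 (diagK (ℋ-dressed generator))`).
They are instance-free: which contact kernel the repaired (L3) carries (the exact finite toy
`HOME/b2b-balaban-beta-an3/gen29/toy/E3LAW-J1-RESULT.md` shows the typed diagonal shape needs the dressed resolvent) is the
row owner's decision; these lemmas serve either reading.

Main statements: `vertexOfK_bref_contact`, `vertexOf_bref_contact` (§1); `comp_add_left`, `sandwich_refK` (§2);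
`mmRead_add`, `mmRead_neg`, `mmRead_sandwich_bref`, `neg_mmRead_sandwich_bref` (§3); `tsum_mul_conjV_diagK`,
`vertexOfK_conjV_diagK` (§4); and the INSTANCE (§5) `vertexOf_S0NAt_bref`: the chain-rule vertex of the step-0 rooted stencil
`S0NAt d Lc (ctr (d+1) Lc) cE cVH cΛ` under `2·cVH = −cE·Lc^{d+1}` reflects with the diagonal contact of the `ℋ`-DRESSED generator
`p c ↦ Σ_κ Σ'_u colH KInv Lc μ y κ u · ctGen d α Lc κ u p c` at coefficient `cVH / Lc^{d+1}` — modulo the two summability binders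
(weights × stencil, weights × generator), which the row owner's decay lemmas (`SpineRooted.locStencil_S0NAt`,
`OneStepResolventKernel.summable_wsumTerm`) are shaped to discharge.
-/

open Finset
open scoped BigOperators
open Literature.MathematicalPhysics.QuantumFieldTheory
open Literature.MathematicalPhysics.QuantumFieldTheory.Balaban1983to89
open Literature.MathematicalPhysics.QuantumFieldTheory.Balaban1983to89.Beta
open ExpKernelCalculus (MKer comp)
open PolarizationSign (reflSign)
open KernelReflection (LegMap refK refK_apply comp_refK comp_smul_left comp_smul_right)
open ResolventReflection (bref bref_bref Φ Φ_r_inl Φ_r_inr Φ_s_inl Φ_s_inr reflSign_mul_self refK_KInv colH_reflect)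
open OneStepResolventKernel (Fib KInv vertexOf wsum)
open OneStepKernelFamily (colH vertexOfK vertexOfK_KInv)
open BalabanStepJetsSucc (mmRead)
open Summit.QuantumFields.BalabanUV.Beta.ChartConjugation (conjV)
open Summit.QuantumFields.BalabanUV.Beta.BorderedHessian (diagK conjV_diagK_apply)
open Summit.QuantumFields.BalabanUV.Beta.SpineRooted (refK_mmRead)

noncomputable section

namespace Summit.QuantumFields.BalabanUV.Beta.VertexReflectionContact

variable {d N : ℕ}

/-! ## §1 The chain-rule vertex of a stencil family with a contact reflection law -/

/-- [folklore] **REFLECTION OF THE CHAIN-RULE VERTEX, WITH CONTACT.**  If the stencil family obeys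
`S κ′ (bref α κ′ u) = ε_{κ′} • refK Φ (S κ′ u + C κ′ u)` and the packed kernel `K` is reflection-invariant, then
`vertexOfK K N S μ (bref α μ y) = ε_μ • refK Φ (vertexOfK K N S μ y + vertexOfK K N C μ y)` — the contact family is carried through
the SAME vertex weights (the `ℋ`-column of `K`).  Summability of the two weighted families is the only analytic input
(`ResolventReflection.vertexOfK_reflect` is the case `C = 0`, where no summability is needed). -/
theorem vertexOfK_bref_contact {K : MKer (d + 1) (Fib d)} {α : Fin (d + 1)} (hK : refK (Φ N α) K = K)
    {S C : Fin (d + 1) → (Fin (d + 1) → ℤ) → MKer (d + 1) (Fib d)}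
    (hSr : ∀ κ' u, S κ' (bref α κ' u) = reflSign α κ' • refK (Φ N α) (S κ' u + C κ' u))
    (hS : ∀ (μ : Fin (d + 1)) (y : Fin (d + 1) → ℤ) (κ' : Fin (d + 1)) (x z : Fin (d + 1) → ℤ) (a b : Fib d),
      Summable fun u => colH K N μ y κ' u * S κ' u x z a b)
    (hC : ∀ (μ : Fin (d + 1)) (y : Fin (d + 1) → ℤ) (κ' : Fin (d + 1)) (x z : Fin (d + 1) → ℤ) (a b : Fib d),
      Summable fun u => colH K N μ y κ' u * C κ' u x z a b)
    (μ : Fin (d + 1)) (y : Fin (d + 1) → ℤ) :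
    vertexOfK K N S μ (bref α μ y) = reflSign α μ • refK (Φ N α) (vertexOfK K N S μ y + vertexOfK K N C μ y) := by
  funext x z a b
  simp only [vertexOfK, OneStepResolventKernel.wsum, Pi.smul_apply, Pi.add_apply, smul_eq_mul, refK_apply]
  have hterm : ∀ κ' : Fin (d + 1), ∑' u, colH K N μ (bref α μ y) κ' u * S κ' u x z a b
      = reflSign α μ * ((Φ N α).s a * (Φ N α).s b) *
          (∑' u, colH K N μ y κ' u * S κ' u ((Φ N α).r a x) ((Φ N α).r b z) a b
            + ∑' u, colH K N μ y κ' u * C κ' u ((Φ N α).r a x) ((Φ N α).r b z) a b) := by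
    intro κ'
    rw [← Equiv.tsum_eq (Function.Involutive.toPerm (bref α κ') (bref_bref α κ'))]
    simp only [Function.Involutive.coe_toPerm]
    rw [← (hS μ y κ' _ _ a b).tsum_add (hC μ y κ' _ _ a b), ← tsum_mul_left]
    refine tsum_congr fun u => ?_
    rw [colH_reflect hK, hSr κ' u]
    simp only [Pi.smul_apply, Pi.add_apply, smul_eq_mul, refK_apply]
    have h1 := reflSign_mul_self α κ'
    calc reflSign α κ' * reflSign α μ * colH K N μ y κ' u *
          (reflSign α κ' * ((Φ N α).s a * (Φ N α).s b *
            (S κ' u ((Φ N α).r a x) ((Φ N α).r b z) a b + C κ' u ((Φ N α).r a x) ((Φ N α).r b z) a b)))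
        = (reflSign α κ' * reflSign α κ') * (reflSign α μ * ((Φ N α).s a * (Φ N α).s b) *
            (colH K N μ y κ' u * S κ' u ((Φ N α).r a x) ((Φ N α).r b z) a b
              + colH K N μ y κ' u * C κ' u ((Φ N α).r a x) ((Φ N α).r b z) a b)) := by ring
      _ = _ := by rw [h1, one_mul]
  calc ∑ κ', ∑' u, colH K N μ (bref α μ y) κ' u * S κ' u x z a b
      = ∑ κ', reflSign α μ * ((Φ N α).s a * (Φ N α).s b) *
          (∑' u, colH K N μ y κ' u * S κ' u ((Φ N α).r a x) ((Φ N α).r b z) a b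
            + ∑' u, colH K N μ y κ' u * C κ' u ((Φ N α).r a x) ((Φ N α).r b z) a b) :=
        Finset.sum_congr rfl fun κ' _ => hterm κ'
    _ = reflSign α μ * ((Φ N α).s a * (Φ N α).s b *
          (∑ κ', ∑' u, colH K N μ y κ' u * S κ' u ((Φ N α).r a x) ((Φ N α).r b z) a b
            + ∑ κ', ∑' u, colH K N μ y κ' u * C κ' u ((Φ N α).r a x) ((Φ N α).r b z) a b)) := by
        rw [← Finset.mul_sum, Finset.sum_add_distrib]
        ring

/-- [folklore] The same through the one-step resolvent `KInv` (`OneStepResolventKernel.vertexOf`), which is reflection-invariant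
(`ResolventReflection.refK_KInv`). -/
theorem vertexOf_bref_contact [NeZero N] {α : Fin (d + 1)}
    {S C : Fin (d + 1) → (Fin (d + 1) → ℤ) → MKer (d + 1) (Fib d)}
    (hSr : ∀ κ' u, S κ' (bref α κ' u) = reflSign α κ' • refK (Φ N α) (S κ' u + C κ' u))
    (hS : ∀ (μ : Fin (d + 1)) (y : Fin (d + 1) → ℤ) (κ' : Fin (d + 1)) (x z : Fin (d + 1) → ℤ) (a b : Fib d),
      Summable fun u => colH (KInv (N := N)) N μ y κ' u * S κ' u x z a b)
    (hC : ∀ (μ : Fin (d + 1)) (y : Fin (d + 1) → ℤ) (κ' : Fin (d + 1)) (x z : Fin (d + 1) → ℤ) (a b : Fib d),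
      Summable fun u => colH (KInv (N := N)) N μ y κ' u * C κ' u x z a b)
    (μ : Fin (d + 1)) (y : Fin (d + 1) → ℤ) :
    vertexOf (N := N) S μ (bref α μ y) = reflSign α μ • refK (Φ N α) (vertexOf (N := N) S μ y + vertexOf (N := N) C μ y) := by
  rw [← vertexOfK_KInv, ← vertexOfK_KInv, ← vertexOfK_KInv]
  exact vertexOfK_bref_contact (refK_KInv α) hSr hS hC μ y

/-! ## §2 The resolvent sandwich of a reflected kernel -/

section Comp

variable {D : ℕ} {F : Type*} [Fintype F]

/-- [folklore] `(K + L) ∘ M = K ∘ M + L ∘ M` (given slice summability; the left-handed twin of `StepJetData.comp_add_right`). -/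
theorem comp_add_left {K L M : MKer D F}
    (hK : ∀ x z a b, Summable fun y : Fin D → ℤ => ∑ f, K x y a f * M y z f b)
    (hL : ∀ x z a b, Summable fun y : Fin D → ℤ => ∑ f, L x y a f * M y z f b) :
    comp (K + L) M = comp K M + comp L M := by
  funext x z a b
  show (∑' y, ∑ f, (K + L) x y a f * M y z f b) = (∑' y, ∑ f, K x y a f * M y z f b) + ∑' y, ∑ f, L x y a f * M y z f b
  rw [← (hK x z a b).tsum_add (hL x z a b)]
  refine tsum_congr fun y => ?_
  rw [← Finset.sum_add_distrib]
  refine Finset.sum_congr rfl fun f _ => ?_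
  simp only [Pi.add_apply]
  ring

/-- [folklore] Per-fibre slice summability gives the fibre-summed slice summability used by `comp_add_left/right`. -/
theorem summable_sliceSum {A K : MKer D F}
    (h : ∀ x z a f b, Summable fun y : Fin D → ℤ => A x y a f * K y z f b) (x z : Fin D → ℤ) (a b : F) :
    Summable fun y : Fin D → ℤ => ∑ f, A x y a f * K y z f b :=
  summable_sum fun f _ => h x z a f b

/-- [folklore] **THE SANDWICH OF A REFLECTED KERNEL BY A REFLECTION-INVARIANT ONE IS THE REFLECTED SANDWICH**:
`K ∘ (Φ·X) ∘ K = Φ·(K ∘ X ∘ K)` when `Φ·K = K` (two applications of `KernelReflection.comp_refK`; slice summability of `K ∘ X`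
and of `(K ∘ X) ∘ K` is the analytic input). -/
theorem sandwich_refK (Ψ : LegMap D F) {K X : MKer D F} (hK : refK Ψ K = K)
    (h1 : ∀ x z a f b, Summable fun y : Fin D → ℤ => K x y a f * X y z f b)
    (h2 : ∀ x z a f b, Summable fun y : Fin D → ℤ => comp K X x y a f * K y z f b) :
    comp (comp K (refK Ψ X)) K = refK Ψ (comp (comp K X) K) := by
  conv_lhs => rw [← hK]
  rw [comp_refK Ψ h1, comp_refK Ψ h2]

end Comp

/-! ## §3 The `mm`-read of the sandwich of a vertex with a contact law -/

/-- [folklore] The `mm`-read is additive. -/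
theorem mmRead_add (M : ℕ) (F G : MKer (d + 1) (Fib d)) : mmRead M (F + G) = mmRead M F + mmRead M G := by
  funext x' z' a b
  rcases a with a | a <;> rcases b with b | b <;> simp [mmRead]

/-- [folklore] The `mm`-read of a negative. -/
theorem mmRead_neg (M : ℕ) (F : MKer (d + 1) (Fib d)) : mmRead M (-F) = -mmRead M F := by
  funext x' z' a b
  rcases a with a | a <;> rcases b with b | b <;> simp [mmRead]

/-- [folklore] **THE `mm`-READ OF THE RESOLVENT SANDWICH OF A VERTEX WITH A CONTACT REFLECTION LAW.**  If the packed kernel `K`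
is invariant under the reflection `Φ M α` of the fine lattice and the vertex family obeys
`V μ (bref α μ y) = ε_μ • refK (Φ M α) (V μ y + W μ y)`, then the third-jet-shaped quantity `mmRead M (K ∘ V μ · ∘ K)` obeys, on the
`M`-times coarser lattice (reflection `Φ N′ α`, ANY modulus `N′` — the `mm`-read has field legs only),
`mmRead M (K ∘ V μ (bref α μ y) ∘ K) = ε_μ • refK (Φ N′ α) (mmRead M (K ∘ V μ y ∘ K) + mmRead M (K ∘ W μ y ∘ K))`.
The four per-fibre slice summabilities are the analytic input; `SpineRooted.refK_mmRead` moves the reflection through the read. -/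
theorem mmRead_sandwich_bref {M N' : ℕ} {α : Fin (d + 1)} {K : MKer (d + 1) (Fib d)} (hK : refK (Φ (d := d) M α) K = K)
    {V W : Fin (d + 1) → (Fin (d + 1) → ℤ) → MKer (d + 1) (Fib d)} {μ : Fin (d + 1)} {y : Fin (d + 1) → ℤ}
    (hV : V μ (bref α μ y) = reflSign α μ • refK (Φ (d := d) M α) (V μ y + W μ y))
    (hKV : ∀ x z a f b, Summable fun t : Fin (d + 1) → ℤ => K x t a f * V μ y t z f b)
    (hKW : ∀ x z a f b, Summable fun t : Fin (d + 1) → ℤ => K x t a f * W μ y t z f b)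
    (hKVK : ∀ x z a f b, Summable fun t : Fin (d + 1) → ℤ => comp K (V μ y) x t a f * K t z f b)
    (hKWK : ∀ x z a f b, Summable fun t : Fin (d + 1) → ℤ => comp K (W μ y) x t a f * K t z f b) :
    mmRead M (comp (comp K (V μ (bref α μ y))) K) =
      reflSign α μ • refK (Φ (d := d) N' α) (mmRead M (comp (comp K (V μ y)) K) + mmRead M (comp (comp K (W μ y)) K)) := by
  have h1 : ∀ x z a f b, Summable fun t : Fin (d + 1) → ℤ => K x t a f * (V μ y + W μ y) t z f b := fun x z a f b => by
    simpa only [Pi.add_apply, mul_add] using (hKV x z a f b).add (hKW x z a f b)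
  have hsplit : comp K (V μ y + W μ y) = comp K (V μ y) + comp K (W μ y) :=
    StepJetData.comp_add_right (summable_sliceSum hKV) (summable_sliceSum hKW)
  have h2 : ∀ x z a f b, Summable fun t : Fin (d + 1) → ℤ => comp K (V μ y + W μ y) x t a f * K t z f b := fun x z a f b => by
    rw [hsplit]
    simpa only [Pi.add_apply, add_mul] using (hKVK x z a f b).add (hKWK x z a f b)
  have hsplit' : comp (comp K (V μ y + W μ y)) K = comp (comp K (V μ y)) K + comp (comp K (W μ y)) K := by
    rw [hsplit]
    exact comp_add_left (summable_sliceSum hKVK) (summable_sliceSum hKWK)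
  -- the `mm`-read is homogeneous (two-line entrywise check; the landed twin `GAN24.ThirdJetKernel.mmRead_smul` is not imported to
  -- keep this leaf's import closure light)
  have mmRead_smul : ∀ (c : ℝ) (F : MKer (d + 1) (Fib d)), mmRead M (c • F) = c • mmRead M F := fun c F => by
    funext x' z' a b
    rcases a with a | a <;> rcases b with b | b <;> simp [mmRead]
  rw [hV, KernelReflection.comp_smul_right, KernelReflection.comp_smul_left, sandwich_refK _ hK h1 h2, hsplit', mmRead_smul,
    ← refK_mmRead, mmRead_add]

/-- [folklore] Relabelling commutes with negation. -/
theorem refK_neg {D : ℕ} {F : Type*} (Ψ : LegMap D F) (X : MKer D F) : refK Ψ (-X) = -refK Ψ X := by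
  funext x z a b
  simp only [refK_apply, Pi.neg_apply, mul_neg]

/-- [folklore] The NEGATED form, matching `SpineRooted.e3NAtOf`'s leading minus sign:
`−mmRead M (K ∘ V μ (bref α μ y) ∘ K) = ε_μ • refK (Φ N′ α) (−mmRead M (K ∘ V μ y ∘ K) + (−mmRead M (K ∘ W μ y ∘ K)))`. -/
theorem neg_mmRead_sandwich_bref {M N' : ℕ} {α : Fin (d + 1)} {K : MKer (d + 1) (Fib d)} (hK : refK (Φ (d := d) M α) K = K)
    {V W : Fin (d + 1) → (Fin (d + 1) → ℤ) → MKer (d + 1) (Fib d)} {μ : Fin (d + 1)} {y : Fin (d + 1) → ℤ}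
    (hV : V μ (bref α μ y) = reflSign α μ • refK (Φ (d := d) M α) (V μ y + W μ y))
    (hKV : ∀ x z a f b, Summable fun t : Fin (d + 1) → ℤ => K x t a f * V μ y t z f b)
    (hKW : ∀ x z a f b, Summable fun t : Fin (d + 1) → ℤ => K x t a f * W μ y t z f b)
    (hKVK : ∀ x z a f b, Summable fun t : Fin (d + 1) → ℤ => comp K (V μ y) x t a f * K t z f b)
    (hKWK : ∀ x z a f b, Summable fun t : Fin (d + 1) → ℤ => comp K (W μ y) x t a f * K t z f b) :
    -mmRead M (comp (comp K (V μ (bref α μ y))) K) =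
      reflSign α μ • refK (Φ (d := d) N' α) (-mmRead M (comp (comp K (V μ y)) K) + -mmRead M (comp (comp K (W μ y)) K)) := by
  rw [mmRead_sandwich_bref hK hV hKV hKW hKVK hKWK, ← neg_add, refK_neg, smul_neg]

/-! ## §4 A family of diagonal contacts contracts through the vertex weights -/

/-- [folklore] **WEIGHTED SUPERPOSITION OF DIAGONAL CONTACTS IS THE CONTACT OF THE SUPERPOSED GENERATOR** (entrywise):
`Σ'_u w u · conjV 𝕄 (diagK (g u)) x z a b = conjV 𝕄 (diagK (p c ↦ Σ'_u w u · g u p c)) x z a b`, given summability of the two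
weighted generator values that enter (`BorderedHessian.conjV_diagK_apply`: a diagonal contact is entrywise
`𝕄 x z a b · (g z b − g x a)`). -/
theorem tsum_mul_conjV_diagK (𝕄 : MKer (d + 1) (Fib d)) {w : (Fin (d + 1) → ℤ) → ℝ}
    {g : (Fin (d + 1) → ℤ) → (Fin (d + 1) → ℤ) → Fib d → ℝ} (x z : Fin (d + 1) → ℤ) (a b : Fib d)
    (hz : Summable fun u => w u * g u z b) (hx : Summable fun u => w u * g u x a) :
    ∑' u, w u * conjV 𝕄 (diagK (g u)) x z a b = conjV 𝕄 (diagK fun p c => ∑' u, w u * g u p c) x z a b := by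
  simp only [conjV_diagK_apply]
  rw [← hz.tsum_sub hx, ← tsum_mul_left]
  refine tsum_congr fun u => ?_
  ring

/-- [folklore] **THE CHAIN-RULE VERTEX OF A FAMILY OF DIAGONAL CONTACTS** `κ u ↦ conjV 𝕄 (diagK (g κ u))` through the packed
kernel `K` IS the diagonal contact of the `ℋ`-DRESSED GENERATOR `p c ↦ Σ_κ Σ'_u colH K N μ y κ u · g κ u p c` — the contact family of
`S0NAtReflection.S0NAt_bref` (`g κ u = γ • ctGen d α Lc κ u`) carried through `vertexOfK`. -/
theorem vertexOfK_conjV_diagK (K 𝕄 : MKer (d + 1) (Fib d)) (N : ℕ)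
    (g : Fin (d + 1) → (Fin (d + 1) → ℤ) → (Fin (d + 1) → ℤ) → Fib d → ℝ)
    (hg : ∀ (μ : Fin (d + 1)) (y : Fin (d + 1) → ℤ) (κ : Fin (d + 1)) (p : Fin (d + 1) → ℤ) (c : Fib d),
      Summable fun u => colH K N μ y κ u * g κ u p c)
    (μ : Fin (d + 1)) (y : Fin (d + 1) → ℤ) :
    vertexOfK K N (fun κ u => conjV 𝕄 (diagK (g κ u))) μ y =
      conjV 𝕄 (diagK fun p c => ∑ κ, ∑' u, colH K N μ y κ u * g κ u p c) := by
  funext x z a b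
  simp only [vertexOfK, OneStepResolventKernel.wsum]
  rw [Finset.sum_congr rfl fun κ _ => tsum_mul_conjV_diagK 𝕄 x z a b (hg μ y κ z b) (hg μ y κ x a)]
  simp only [conjV_diagK_apply]
  rw [← Finset.mul_sum, Finset.sum_sub_distrib]

/-! ## §5 The instance: the chain-rule vertex of the step-0 rooted stencil of the spine -/

section Instance

open B12Sec2to5 (l1 l1_nonneg)
open ExpKernelCalculus (Decays BiLoc summable_exp_shift')
open AffineAveraging (box toSite)
open AveragingContours (blk off)
open AveragingContoursRooted (ctr ctrOff ctrOff_mem_box)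
open AveragingHessianKernels (ell)
open AveragingHessianKernelsRooted (linKerAt abs_linKerAt_le)
open OneStepResolventKernel (LocStencil decays_KInv bound_mono biLoc_mono summable_wsumTerm)
open OneStepKernelFamily (abs_colH_le)
open Summit.QuantumFields.BalabanUV.Beta.BorderedHessian (bhKAt ctGen ctGen_inl ctGen_inr diagK_apply)
open Summit.QuantumFields.BalabanUV.Beta.SpineRooted (S0NAt locStencil_S0NAt)
open Summit.QuantumFields.BalabanUV.Beta.S0NAtReflection (S0NAt_bref)

/-- [folklore] A scalar multiple of a diagonal kernel is the diagonal kernel of the scaled symbol. -/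
theorem smul_diagK (c : ℝ) (g : (Fin (d + 1) → ℤ) → Fib d → ℝ) : c • diagK g = diagK (fun p a => c * g p a) := by
  classical
  funext x y a b
  simp only [Pi.smul_apply, smul_eq_mul, diagK_apply]
  split_ifs <;> simp

variable {Lc : ℕ}

/-! ### §5a Summability of the vertex weights against a local stencil family and against the generator -/

/-- [folklore] **THE VERTEX WEIGHTS OF A DECAYING KERNEL AGAINST A LOCAL STENCIL FAMILY ARE SUMMABLE** (rates matched by `min`;
`OneStepResolventKernel.summable_wsumTerm`). -/
theorem summable_colH_mul_of_locStencil {N : ℕ} {K : MKer (d + 1) (Fib d)} (hK : ∃ δ C : ℝ, 0 < δ ∧ 0 ≤ C ∧ Decays K C δ)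
    {S : Fin (d + 1) → (Fin (d + 1) → ℤ) → MKer (d + 1) (Fib d)} {Cs δ : ℝ} (hS : LocStencil S Cs δ) (hδ : 0 < δ)
    (μ : Fin (d + 1)) (y : Fin (d + 1) → ℤ) (κ' : Fin (d + 1)) (x z : Fin (d + 1) → ℤ) (a b : Fib d) :
    Summable fun u => colH K N μ y κ' u * S κ' u x z a b := by
  obtain ⟨δK, C, hδK, hC, h⟩ := hK
  have hCs : 0 ≤ Cs := (hS 0 0).nonneg (Sum.inl 0)
  have hS' : ∀ u, BiLoc (S κ' u) u u Cs (min δ δK) := fun u => biLoc_mono (hS κ' u) hCs (min_le_left _ _)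
  have hw : ∀ u, |colH K N μ y κ' u| ≤ C * Real.exp (-(min δ δK) * l1 (u - (N : ℤ) • y)) := fun u =>
    bound_mono (abs_colH_le (N := N) h μ y κ' u) hC le_rfl (min_le_right _ _) (l1_nonneg _)
  exact summable_wsumTerm hw hS' (lt_min hδ hδK) hC x z a b

/-- [folklore] **THE PRODUCT-CHART GENERATOR IS UNIFORMLY BOUNDED**: `|ctGen d α Lc κ u p c| ≤ max 1 ℓ` (field leg `∈ {0, −1}`,
multiplier leg a rooted contour number `|q¹| ≤ ℓ`, `AveragingHessianKernelsRooted.abs_linKerAt_le`). -/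
theorem abs_ctGen_le (hLc : 1 ≤ Lc) (α κ : Fin (d + 1)) (u p : Fin (d + 1) → ℤ) (c : Fib d) :
    |ctGen d α Lc κ u p c| ≤ max 1 (ell (d + 1) Lc : ℝ) := by
  classical
  rcases c with β | μ
  · rw [ctGen_inl]
    split_ifs
    · rw [abs_neg, abs_one]; exact le_max_left _ _
    · rw [abs_zero]; exact zero_le_one.trans (le_max_left _ _)
  · rw [ctGen_inr]
    split_ifs
    · rw [abs_neg]
      exact (abs_linKerAt_le hLc μ (blk Lc p) (ctrOff_mem_box hLc) (κ, u)).trans (le_max_right _ _)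
    · rw [abs_zero]; exact zero_le_one.trans (le_max_left _ _)

/-- [folklore] **THE VERTEX WEIGHTS OF A DECAYING KERNEL AGAINST THE GENERATOR VALUES ARE SUMMABLE** (decaying × bounded). -/
theorem summable_colH_mul_ctGen {N : ℕ} {K : MKer (d + 1) (Fib d)} (hK : ∃ δ C : ℝ, 0 < δ ∧ 0 ≤ C ∧ Decays K C δ) (hLc : 1 ≤ Lc)
    (α μ : Fin (d + 1)) (y : Fin (d + 1) → ℤ) (κ : Fin (d + 1)) (p : Fin (d + 1) → ℤ) (c : Fib d) :
    Summable fun u => colH K N μ y κ u * ctGen d α Lc κ u p c := by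
  obtain ⟨δK, C, hδK, hC, h⟩ := hK
  refine Summable.of_norm_bounded (((summable_exp_shift' hδK ((N : ℤ) • y)).mul_left C).mul_right (max 1 (ell (d + 1) Lc : ℝ)))
    (fun u => ?_)
  rw [Real.norm_eq_abs, abs_mul]
  exact mul_le_mul (abs_colH_le (N := N) h μ y κ u) (abs_ctGen_le hLc α κ u p c) (abs_nonneg _)
    (mul_nonneg hC (Real.exp_pos _).le)

variable [NeZero Lc]

/-! ### §5b The instance -/


/-- [folklore] **THE CHAIN-RULE VERTEX OF THE STEP-0 ROOTED STENCIL REFLECTS WITH THE CONTACT OF THE `ℋ`-DRESSED GENERATOR.**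
Under the relative normalisation `2·cVH = −cE·Lc^{d+1}` of `S0NAtReflection.S0NAt_bref` (odd `Lc`, centre root), for every coarse bond
`(μ, y)`:
`vertexOf (S0NAt …) μ (bref α μ y) = ε_μ • refK (Φ Lc α) (vertexOf (S0NAt …) μ y + conjV (bhKAt …) ((cVH/Lc^{d+1}) • diagK Gᵛ))`,
`Gᵛ p c := Σ_κ Σ'_u colH KInv Lc μ y κ u · ctGen d α Lc κ u p c` (the product-chart generators of all jet bonds, weighted by the
`ℋ`-column of the one-step resolvent).  The two summability binders are the only analytic input. -/
theorem vertexOf_S0NAt_bref (hLc : Odd Lc) {cE cVH : ℝ} (cΛ : ℝ) (hn : 2 * cVH = -(cE * (Lc : ℝ) ^ (d + 1))) (α : Fin (d + 1))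
    (hS : ∀ (μ : Fin (d + 1)) (y : Fin (d + 1) → ℤ) (κ' : Fin (d + 1)) (x z : Fin (d + 1) → ℤ) (a b : Fib d),
      Summable fun u => colH (KInv (N := Lc)) Lc μ y κ' u * S0NAt d Lc (ctr (d + 1) Lc) cE cVH cΛ κ' u x z a b)
    (hG : ∀ (μ : Fin (d + 1)) (y : Fin (d + 1) → ℤ) (κ : Fin (d + 1)) (p : Fin (d + 1) → ℤ) (c : Fib d),
      Summable fun u => colH (KInv (N := Lc)) Lc μ y κ u * ctGen d α Lc κ u p c)
    (μ : Fin (d + 1)) (y : Fin (d + 1) → ℤ) :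
    vertexOf (N := Lc) (S0NAt d Lc (ctr (d + 1) Lc) cE cVH cΛ) μ (bref α μ y) =
      reflSign α μ • refK (Φ Lc α) (vertexOf (N := Lc) (S0NAt d Lc (ctr (d + 1) Lc) cE cVH cΛ) μ y +
        conjV (bhKAt d (ctr (d + 1) Lc) Lc) ((cVH / (Lc : ℝ) ^ (d + 1)) •
          diagK (fun p c => ∑ κ, ∑' u, colH (KInv (N := Lc)) Lc μ y κ u * ctGen d α Lc κ u p c))) := by
  -- the contact family of `S0NAt_bref`, with the scalar pushed into the generator symbol
  have hSr : ∀ κ' u, S0NAt d Lc (ctr (d + 1) Lc) cE cVH cΛ κ' (bref α κ' u) =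
      reflSign α κ' • refK (Φ Lc α) (S0NAt d Lc (ctr (d + 1) Lc) cE cVH cΛ κ' u +
        conjV (bhKAt d (ctr (d + 1) Lc) Lc) (diagK fun p c => cVH / (Lc : ℝ) ^ (d + 1) * ctGen d α Lc κ' u p c)) := by
    intro κ' u
    rw [S0NAt_bref hLc cΛ hn α κ' u, smul_diagK]
  have hgs : ∀ (μ : Fin (d + 1)) (y : Fin (d + 1) → ℤ) (κ : Fin (d + 1)) (p : Fin (d + 1) → ℤ) (c : Fib d),
      Summable fun u => colH (KInv (N := Lc)) Lc μ y κ u * (cVH / (Lc : ℝ) ^ (d + 1) * ctGen d α Lc κ u p c) :=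
    fun μ y κ p c => ((hG μ y κ p c).mul_left (cVH / (Lc : ℝ) ^ (d + 1))).congr fun u => by ring
  have hC : ∀ (μ : Fin (d + 1)) (y : Fin (d + 1) → ℤ) (κ' : Fin (d + 1)) (x z : Fin (d + 1) → ℤ) (a b : Fib d),
      Summable fun u => colH (KInv (N := Lc)) Lc μ y κ' u *
        conjV (bhKAt d (ctr (d + 1) Lc) Lc) (diagK fun p c => cVH / (Lc : ℝ) ^ (d + 1) * ctGen d α Lc κ' u p c) x z a b := by
    intro μ y κ' x z a b
    simp only [conjV_diagK_apply]
    exact (((hgs μ y κ' z b).sub (hgs μ y κ' x a)).mul_left (bhKAt d (ctr (d + 1) Lc) Lc x z a b)).congr fun u => by ring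
  have hGen : (fun p c => ∑ κ, ∑' u, colH (KInv (N := Lc)) Lc μ y κ u * (cVH / (Lc : ℝ) ^ (d + 1) * ctGen d α Lc κ u p c))
      = fun p c => cVH / (Lc : ℝ) ^ (d + 1) * ∑ κ, ∑' u, colH (KInv (N := Lc)) Lc μ y κ u * ctGen d α Lc κ u p c := by
    funext p c
    rw [Finset.mul_sum]
    refine Finset.sum_congr rfl fun κ _ => ?_
    rw [← tsum_mul_left]
    exact tsum_congr fun u => by ring
  rw [vertexOf_bref_contact hSr hS hC μ y,
    ← vertexOfK_KInv (fun κ u => conjV (bhKAt d (ctr (d + 1) Lc) Lc) (diagK fun p c => cVH / (Lc : ℝ) ^ (d + 1) * ctGen d α Lc κ u p c)),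
    vertexOfK_conjV_diagK _ _ Lc _ hgs μ y, hGen, smul_diagK]

/-- [folklore] **THE INSTANCE, BINDER-FREE**: `vertexOf_S0NAt_bref` with both summability binders discharged by the decay of the
one-step resolvent (`decays_KInv`), the locality of the step-0 rooted stencil (`SpineRooted.locStencil_S0NAt`, centre root
`ctr = toSite ctrOff`, `ctrOff_mem_box`) and the uniform bound on the generator (`abs_ctGen_le`). -/
theorem vertexOf_S0NAt_bref' (hLc : Odd Lc) {cE cVH : ℝ} (cΛ : ℝ) (hn : 2 * cVH = -(cE * (Lc : ℝ) ^ (d + 1))) (α μ : Fin (d + 1))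
    (y : Fin (d + 1) → ℤ) :
    vertexOf (N := Lc) (S0NAt d Lc (ctr (d + 1) Lc) cE cVH cΛ) μ (bref α μ y) =
      reflSign α μ • refK (Φ Lc α) (vertexOf (N := Lc) (S0NAt d Lc (ctr (d + 1) Lc) cE cVH cΛ) μ y +
        conjV (bhKAt d (ctr (d + 1) Lc) Lc) ((cVH / (Lc : ℝ) ^ (d + 1)) •
          diagK (fun p c => ∑ κ, ∑' u, colH (KInv (N := Lc)) Lc μ y κ u * ctGen d α Lc κ u p c))) := by
  have hLc1 : 1 ≤ Lc := Nat.one_le_iff_ne_zero.2 (NeZero.ne Lc)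
  obtain ⟨Cs, δ, hδ, hS⟩ := locStencil_S0NAt (d := d) (Lc := Lc) hLc1 (ctrOff_mem_box hLc1) cE cVH cΛ
  exact vertexOf_S0NAt_bref hLc cΛ hn α
    (fun μ y κ' x z a b => summable_colH_mul_of_locStencil (decays_KInv (N := Lc) (d := d)) hS hδ μ y κ' x z a b)
    (fun μ y κ p c => summable_colH_mul_ctGen (decays_KInv (N := Lc) (d := d)) hLc1 α μ y κ p c) μ y

end Instance

end Summit.QuantumFields.BalabanUV.Beta.VertexReflectionContact

end
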